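import Literature.Probability.Percolation.ArmSeparationExtArm
import Literature.Probability.Percolation.ArmSeparationInwardExt
import HarnessLib

/-!
# Outward extension of arms landed on the outer boundary, at constant cost (Nolin 2008, Prop. 12 (i))

Topic: Probability / Percolation; family `crit-perc` (critical site percolation on `𝕋`,
`P = P_{1/2} = triSitePercolation half`). A brick of the discharge of
`Literature.Probability.Percolation.Nolin2008_twoArm_separation` (Nolin 2008, Thm. 11
[arXiv 0711.4948: Thm. 10], `j = 2`, `σ = BW`; `ArmSeparation.lean`): the constant-cost
extension step `h K ≤ C₀ · h (K+1)` of the multi-scale scheme (`ArmSeparationScheme.lean`) for the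
EXTERNAL extremities, i.e. for the arms landed on the outer boundary only, `extTwoArm n R` of
`ArmSeparationExtArm.lean`:

  `P(extTwoArm n R) · (c₂₅₆^93)² ≤ P(extTwoArm n R')`  for `2200 ≤ R`, `2n ≤ R`, `2R ≤ R' ≤ 32R`

(Nolin 2008, §4.4, p. 12: "for the size `η'₀`, going from `∂S_m` to `∂S_{2m}` has a cost `C'₀`
depending only on `η'₀` on each scale"; Prop. 12 (i) [arXiv Prop. 11] "once well-separated, the
arms can easily be extended"). As printed, the proof is a finite RSW gluing construction combined
with the generalised FKG inequality for locally monotone events (Nolin's Lemma 13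
[arXiv Lemma 12], `triSitePercolation_locallyMonotone_fkg`); it is the outward twin of
`ArmSeparationInwardExt.lean`, whose comb arithmetic (`exists_sepInComb_rows`) is reused:

* `sepOutCorr R R'` — the **outward corridor** (all boxes in `{x₀ > R}`): the `90` comb boxes
  `[R+1, R+2(R/8)+1] × [g_i, g_i + h]` (`h = (R/64)/2`) covering the rows of every outer free space
  `sepOuterFence R z`, `z ∈ sepLanding R`; the "highway" `[R+R/8+1, R+2(R/8)+1] × [-(R'/2), 0]`
  crossed vertically; the horizontal box `[R+R/8+1, R'+R'/16] × [-(R'/2), -(R'/2)+R'/64]`; and a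
  vertical crossing of the thinned target free space `[R'+1, R'+R'/16] × [-(R'/2) - R'/64, -(R'/2) + R'/64]`
  at the landing site `z'' = (R', -R'/2)` of `∂Λ_{R'}`;
* `extOpenArm_inter_sepOutCorr_subset` — **deterministic gluing**:
  `extOpenArm n R ∩ sepOutCorr R R' ⊆ extOpenArm n R'`; by the symmetry `negFlip`,
  `extTwoArm_inter_sepOutCorr_subset`;
* `le_real_sepOutCorr` — `P(sepOutCorr R R') ≥ c₂₅₆^93`;
* `real_extTwoArm_mul_le_outward`, `exists_real_extTwoArm_le_mul_outward` — the extension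
  inequality, by Nolin's Lemma 13 with the shared region `{n ≤ |v| ≤ R}`, the region
  `{R < |v|, x₀ > 0}` (open arm's outer free space and corridor) and `{R < |v|, x₀ < 0}` (closed
  arm's), and the invariance of `P_{1/2}` under `negFlip`.

## References

* P. Nolin, *Near-critical percolation in two dimensions*, Electron. J. Probab. 13 (2008), §4.3
  Prop. 12 (i) and Lemma 13, §4.4 (proof of Thm. 11, external extremities: the constant `C₀`)
  [arXiv 0711.4948: Prop. 11, Lemma 12, Thm. 10, p. 12]. [Nolin2008]
* H. Kesten, *Scaling relations for 2D-percolation*, Comm. Math. Phys. 109 (1987), Lemma 2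
  (extension of arms through fences). [Kesten1987]

Tree: `extOpenArm`, `extTwoArm`, `isUpperSet_extOpenArm`, `determinedBy_extOpenArm`,
`extSupportSet` (`ArmSeparationExtArm.lean`); `exists_sepInComb_rows`, `mk_mem_sepLanding`
(`ArmSeparationInwardExt.lean`); `sepOuterFence`, `sepLanding`, `OpenVCrossThrough`, `negFlip`,
`sepGlueHeight` (`ArmSeparation.lean`); `PathIn.relay` (`ArmSeparationGlue.lean`);
`exists_mem_of_cross` (`ArmEventsAPriori.lean`); `triSitePercolation_locallyMonotone_fkg`
(`LocallyMonotoneFKG.lean`); `triHCross`, `triVCross` (`TriRSWChaining.lean`);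
`sitePercolation_real_biInter_ge_prod` (`SiteHarrisChain.lean`); `tri_rsw_half_holds`
(`TriThetaHalf.lean`).
-/

noncomputable section

open MeasureTheory Set

namespace Literature.Probability.Percolation

open LatticeModels

/-! ### The outward corridor -/

/-- The `i`-th outer comb box `[R+1, R+2(R/8)+1] × [g_i, g_i + h]`, `g_i = -(R - R/4 + R/64) + i h`,
`h = (R/64)/2`, crossed horizontally. [cite: Nolin2008, §4.3 Prop. 12 (proof) (arXiv 0711.4948: Prop. 11)] -/
def sepOutComb (R i : ℕ) : Set (SiteConfig (Site 2)) :=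
  triHCross ((R : ℤ) + 1) (-(sepGlueHeight R : ℤ) + i * ((R / 64 / 2 : ℕ) : ℤ)) (2 * (R / 8)) (R / 64 / 2)

/-- Membership in the strip of an outer comb box. [folklore] -/
theorem sepOutComb_strip_iff {R i : ℕ} {v : Site 2} :
    v ∈ triStrip ((R : ℤ) + 1) (-(sepGlueHeight R : ℤ) + i * ((R / 64 / 2 : ℕ) : ℤ)) (2 * (R / 8)) (R / 64 / 2) ↔
      (R : ℤ) + 1 ≤ v 0 ∧ v 0 ≤ (R : ℤ) + 1 + 2 * (R / 8 : ℕ) ∧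
        -(sepGlueHeight R : ℤ) + i * ((R / 64 / 2 : ℕ) : ℤ) ≤ v 1 ∧ v 1 ≤ -(sepGlueHeight R : ℤ) + i * ((R / 64 / 2 : ℕ) : ℤ) + (R / 64 / 2 : ℕ) := by
  rw [mem_triStrip]
  constructor <;> rintro ⟨h1, h2, h3, h4⟩ <;> exact ⟨h1, by push_cast at h2 ⊢; omega, h3, h4⟩

/-- **The outward corridor** from the outer free spaces at scale `R` (right side of `Λ_R`) to the
outer free space `sepOuterFence R' (R', -R'/2)` at scale `R'`: (i) an open vertical crossing of
the thinned target free space `[R'+1, R'+R'/16] × [-R'/2 - R'/64, -R'/2 + R'/64]`; (ii) an open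
horizontal crossing of `[R+R/8+1, R'+R'/16] × [-R'/2, -R'/2 + R'/64]`; (iii) an open vertical
crossing of the highway `[R+R/8+1, R+2(R/8)+1] × [-(R'/2), 0]`; (iv) the `90` comb boxes crossed
horizontally. [cite: Nolin2008, §4.3 Prop. 12 (proof) (arXiv 0711.4948: Prop. 11)] -/
def sepOutCorr (R R' : ℕ) : Set (SiteConfig (Site 2)) :=
  triVCross ((R' : ℤ) + 1) (-((R' / 2 : ℕ) : ℤ) - (R' / 64 : ℕ)) (R' / 16 - 1) (2 * (R' / 64)) ∩
    triHCross ((R : ℤ) + (R / 8 : ℕ) + 1) (-((R' / 2 : ℕ) : ℤ)) (R' + R' / 16 - (R + R / 8 + 1)) (R' / 64) ∩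
    triVCross ((R : ℤ) + (R / 8 : ℕ) + 1) (-((R' / 2 : ℕ) : ℤ)) (R / 8) (R' / 2) ∩
    ⋂ i ∈ Finset.range 90, sepOutComb R i

/-- `sepOutCorr` is increasing. [folklore] -/
theorem isUpperSet_sepOutCorr (R R' : ℕ) : IsUpperSet (sepOutCorr R R') := by
  refine (((isUpperSet_triVCross _ _ _ _).inter (isUpperSet_triHCross _ _ _ _)).inter
    (isUpperSet_triVCross _ _ _ _)).inter ?_
  exact isUpperSet_iInter₂ fun i _ => isUpperSet_triHCross _ _ _ _

/-! ### Regions -/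

section Regions

variable {n R R' : ℕ}

/-- Casting the width of the horizontal box. [folklore] -/
theorem cast_sepOutCorr_width (hR' : 64 ≤ R') (hRR' : 2 * R ≤ R') :
    ((R' + R' / 16 - (R + R / 8 + 1) : ℕ) : ℤ) = (R' : ℤ) + (R' / 16 : ℕ) - R - (R / 8 : ℕ) - 1 := by
  omega

/-- The horizontal box `[R+R/8+1, R'+R'/16] × [-R'/2, -R'/2 + R'/64]` lies in the new arm region:
its sites beyond `Λ_{R'}` are in the attaching ball `S̊_{R'/8}(z'')`, the others in the annulus
`{n ≤ |v| ≤ R'}` (`64 ≤ R'`, `n ≤ R`, `2R ≤ R'`). [cite: Nolin2008, §4.2 Def. 6 (arXiv 0711.4948)] -/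
theorem sepOutCorrHBox_subset (hR' : 64 ≤ R') (hnR : n ≤ R) (hRR' : 2 * R ≤ R') :
    triStrip ((R : ℤ) + (R / 8 : ℕ) + 1) (-((R' / 2 : ℕ) : ℤ)) (R' + R' / 16 - (R + R / 8 + 1)) (R' / 64) ⊆
      triAnnulusSet n R' ∪ triOpenBall ![(R' : ℤ), -((R' / 2 : ℕ) : ℤ)] (R' / 8) := by
  intro v hv
  rw [mem_triStrip, cast_sepOutCorr_width hR' hRR'] at hv
  have hnR' : (n : ℤ) ≤ R := by exact_mod_cast hnR
  rcases le_or_gt (v 0) (R' : ℤ) with h0 | h0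
  · refine Or.inl ⟨le_triNorm_iff_lin.2 (Or.inl (by omega)), triNorm_le_iff_lin.2 ?_⟩
    omega
  · refine Or.inr ?_
    rw [mem_triOpenBall, triNorm_lt_iff_lin]
    simp only [Pi.sub_apply, site_mk_apply_zero, site_mk_apply_one]
    omega

/-- The highway and the comb boxes lie in the annulus `{n ≤ |v| ≤ R'}`: columns in
`[R+1, R+2(R/8)+1]`, rows in `[-(R'/2), 0]` (`n ≤ R`, `2R ≤ R'`). [folklore] -/
theorem mem_triAnnulusSet_of_cols_rows_out (hR : 64 ≤ R) (hnR : n ≤ R) (hRR' : 2 * R ≤ R') {v : Site 2}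
    (h0 : (R : ℤ) + 1 ≤ v 0) (h0' : v 0 ≤ (R : ℤ) + 1 + 2 * (R / 8 : ℕ)) (h1 : -((R' / 2 : ℕ) : ℤ) ≤ v 1) (h1' : v 1 ≤ 0) :
    v ∈ triAnnulusSet n R' := by
  have hnR' : (n : ℤ) ≤ R := by exact_mod_cast hnR
  refine ⟨le_triNorm_iff_lin.2 (Or.inl (by omega)), triNorm_le_iff_lin.2 ?_⟩
  omega

/-- An outer free space at scale `R` lies in the annulus `{n ≤ |v| ≤ R'}` (`n ≤ R`, `2R ≤ R'`). [cite: Nolin2008, §4.2 Def. 6 (arXiv 0711.4948)] -/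
theorem sepOuterFence_subset_triAnnulusSet (hnR : n ≤ R) (hRR' : 2 * R ≤ R') {z : Site 2} (hz : z ∈ sepLanding R) :
    sepOuterFence R z ⊆ triAnnulusSet n R' := by
  intro v hv
  rw [mem_sepOuterFence] at hv
  rw [mem_sepLanding] at hz
  have hnR' : (n : ℤ) ≤ R := by exact_mod_cast hnR
  refine ⟨le_triNorm_iff_lin.2 (Or.inl (by omega)), triNorm_le_iff_lin.2 ?_⟩
  omega

/-- The old arm region lies in the new annulus: `{n ≤ |v| ≤ R} ∪ S̊_{R/8}(z) ⊆ {n ≤ |v| ≤ R'}`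
(`2n ≤ R`, `2R ≤ R'`, `z ∈ sepLanding R`). [cite: Nolin2008, §4.2 Def. 6 (arXiv 0711.4948)] -/
theorem extRegion_subset_triAnnulusSet (hnR : 2 * n ≤ R) (hRR' : 2 * R ≤ R') {z : Site 2} (hz : z ∈ sepLanding R) :
    triAnnulusSet n R ∪ triOpenBall z (R / 8) ⊆ triAnnulusSet n R' := by
  rw [mem_sepLanding] at hz
  obtain ⟨hz0, hz1, hz2⟩ := hz
  have hnR' : 2 * (n : ℤ) ≤ R := by exact_mod_cast hnR
  have hRR : 2 * (R : ℤ) ≤ R' := by exact_mod_cast hRR'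
  rintro v (hv | hv)
  · rw [mem_triAnnulusSet] at hv
    exact ⟨hv.1, by omega⟩
  · rw [mem_triOpenBall, triNorm_lt_iff_lin] at hv
    simp only [Pi.sub_apply] at hv
    refine ⟨le_triNorm_iff_lin.2 (Or.inl (by omega)), triNorm_le_iff_lin.2 ?_⟩
    omega

/-- The thinned target free space lies in the target free space `sepOuterFence R' z''`,
`z'' = (R', -R'/2)` (`16 ≤ R'`). [folklore] -/
theorem sepOutCorrFence_subset_sepOuterFence (hR' : 16 ≤ R') :
    triStrip ((R' : ℤ) + 1) (-((R' / 2 : ℕ) : ℤ) - (R' / 64 : ℕ)) (R' / 16 - 1) (2 * (R' / 64)) ⊆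
      sepOuterFence R' ![(R' : ℤ), -((R' / 2 : ℕ) : ℤ)] := by
  intro v hv
  rw [mem_triStrip] at hv
  rw [mem_sepOuterFence, site_mk_apply_one]
  have e : ((R' / 16 - 1 : ℕ) : ℤ) = (R' / 16 : ℕ) - 1 := by omega
  rw [e] at hv
  push_cast at hv
  omega

end Regions

/-! ### The deterministic gluing -/

/-- **Outward extension of an arm landed on the outer boundary along the corridor** (Nolin 2008,
Prop. 12 (i), "once well-separated, the arms can easily be extended"; Kesten's fences):
`extOpenArm n R ∩ sepOutCorr R R' ⊆ extOpenArm n R'` for `2200 ≤ R`, `2n ≤ R`, `2R ≤ R'`. The comb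
box whose rows lie inside the old outer free space (`exists_sepInComb_rows`) meets the vertical
crossing of that free space through the old attaching site `u'`, and meets the highway, which
meets the horizontal box, which meets the vertical crossing of the thinned target free space at
the new attaching site `p₁` (`PathIn.relay`, `exists_mem_of_cross`); all pieces lie in the new arm
region `{n ≤ |v| ≤ R'} ∪ S̊_{R'/8}(z'')`. [cite: Nolin2008, §4.3 Prop. 12 (i) (proof) (arXiv 0711.4948: Prop. 11); §4.4 p. 12 (constant C₀)] -/
theorem extOpenArm_inter_sepOutCorr_subset {n R R' : ℕ} (hR : 2200 ≤ R) (hnR : 2 * n ≤ R) (hRR' : 2 * R ≤ R') :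
    extOpenArm n R ∩ sepOutCorr R R' ⊆ extOpenArm n R' := by
  rintro ω ⟨⟨z, u', a, hz, ha, ⟨b, t, hb, ht, Pa, Pb⟩, P⟩, ⟨⟨⟨hV0, hH0⟩, hVh⟩, hG⟩⟩
  have hzL := hz
  rw [mem_sepLanding] at hzL
  obtain ⟨hz0, hz1, hz2⟩ := hzL
  -- the new landing site
  set z'' : Site 2 := ![(R' : ℤ), -((R' / 2 : ℕ) : ℤ)] with hz''
  have hz''1 : z'' 1 = -((R' / 2 : ℕ) : ℤ) := site_mk_apply_one _ _
  -- the corridor paths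
  obtain ⟨b₀, t₀, hb₀, ht₀, PV⟩ := hV0
  obtain ⟨a₀, e₀, ha₀, he₀, PH⟩ := hH0
  obtain ⟨bh, th, hbh, hth, PVh⟩ := hVh
  obtain ⟨i, hi, hgi1, hgi2⟩ := exists_sepInComb_rows hR hz
  have hGi : ω ∈ sepOutComb R i := (Set.mem_iInter₂.1 hG) i (Finset.mem_range.2 hi)
  obtain ⟨g₀, g₁, hg₀, hg₁, PG⟩ := hGi
  rw [cast_sepOutCorr_width (by omega) hRR'] at he₀
  have hH : (sepGlueHeight R : ℤ) = (R : ℤ) - (R / 4 : ℕ) + (R / 64 : ℕ) := by unfold sepGlueHeight; omega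
  simp only [Nat.cast_mul, Nat.cast_ofNat] at ht₀ hg₁
  have hih : (0 : ℤ) ≤ (i : ℤ) * ((R / 64 / 2 : ℕ) : ℤ) := by positivity
  have hRR : 2 * (R : ℤ) ≤ R' := by exact_mod_cast hRR'
  have e16 : ((R' / 16 - 1 : ℕ) : ℤ) = (R' / 16 : ℕ) - 1 := by omega
  -- junction 1: the horizontal box meets the vertical crossing of the target free space
  obtain ⟨SH, hSH, PH', TH⟩ := PH.exists_support
  obtain ⟨SV, hSV, PV', TV⟩ := PV.exists_support
  obtain ⟨p₁, hp₁H, hp₁V⟩ := exists_mem_of_cross (L := (R' : ℤ) + 1) (R := (R' : ℤ) + (R' / 16 : ℕ))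
    (B := -((R' / 2 : ℕ) : ℤ) - (R' / 64 : ℕ)) (T := -((R' / 2 : ℕ) : ℤ) + (R' / 64 : ℕ)) (by omega) (by omega)
    PH' (by omega) (by omega)
    (fun v hv _ _ => by have h := (hSH hv).1; rw [mem_triStrip] at h; omega)
    PV' hb₀.le (by omega)
    (fun v hv _ _ => by
      have h := (hSV hv).1; rw [mem_triStrip, e16] at h
      omega)
  -- the new free space is crossed through `p₁`
  have hSVF : SV ⊆ sepOuterFence R' z'' ∩ ω := fun v hv => ⟨sepOutCorrFence_subset_sepOuterFence (by omega) (hSV hv).1, (hSV hv).2⟩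
  have hFence : OpenVCrossThrough (sepOuterFence R' z'') (z'' 1 - (R' / 64 : ℕ)) (z'' 1 + (R' / 64 : ℕ)) ω p₁ :=
    ⟨b₀, t₀, by rw [hz''1, hb₀], by rw [hz''1, ht₀]; ring, (TV p₁ hp₁V).mono hSVF,
      ((TV p₁ hp₁V).symm.trans (TV t₀ PV'.right_mem)).mono hSVF⟩
  -- junctions 2–4 by relays
  have Q1 : PathIn triGraph (triStrip ((R : ℤ) + (R / 8 : ℕ) + 1) (-((R' / 2 : ℕ) : ℤ)) (R' + R' / 16 - (R + R / 8 + 1)) (R' / 64) ∩ ω)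
      a₀ p₁ := (TH p₁ hp₁H).mono hSH
  have Q2 := PathIn.relay (L := (R : ℤ) + (R / 8 : ℕ) + 1) (R := (R : ℤ) + 1 + 2 * (R / 8 : ℕ))
    (B := -((R' / 2 : ℕ) : ℤ)) (T := 0) (by omega) (by omega) PH (by omega) (by omega)
    (fun v hv _ _ => by rw [mem_triStrip] at hv; omega) PVh hbh.le (by omega)
    (fun v hv _ _ => by rw [mem_triStrip] at hv; omega)
  have Q3 := PathIn.relay (L := (R : ℤ) + (R / 8 : ℕ) + 1) (R := (R : ℤ) + 1 + 2 * (R / 8 : ℕ))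
    (B := -((R' / 2 : ℕ) : ℤ)) (T := 0) (by omega) (by omega) PG (by omega) (by omega)
    (fun v hv _ _ => by rw [sepOutComb_strip_iff] at hv; omega) PVh hbh.le (by omega)
    (fun v hv _ _ => by rw [mem_triStrip] at hv; omega)
  have Q4 := PathIn.relay (L := (R : ℤ) + 1) (R := (R : ℤ) + (R / 8 : ℕ)) (B := z 1 - (R / 64 : ℕ)) (T := z 1 + (R / 64 : ℕ))
    (by omega) (by omega) PG (by omega) (by omega)
    (fun v hv _ _ => by rw [sepOutComb_strip_iff] at hv; omega) (Pa.trans Pb) hb.le ht.ge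
    (fun v hv _ _ => by rw [mem_sepOuterFence] at hv; omega)
  -- assemble inside the new arm region
  have R1 := sepOutCorrHBox_subset (n := n) (R := R) (R' := R') (by omega) (by omega) hRR'
  have R4 := sepOuterFence_subset_triAnnulusSet (n := n) (R' := R') (by omega) hRR' hz
  have R5 := extRegion_subset_triAnnulusSet hnR hRR' hz
  have RVh : triStrip ((R : ℤ) + (R / 8 : ℕ) + 1) (-((R' / 2 : ℕ) : ℤ)) (R / 8) (R' / 2) ⊆ triAnnulusSet n R' :=
    fun v hv => by
      rw [mem_triStrip] at hv
      exact mem_triAnnulusSet_of_cols_rows_out (by omega) (by omega) hRR' (by omega) (by omega) hv.2.2.1 (by omega)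
  have RG : triStrip ((R : ℤ) + 1) (-(sepGlueHeight R : ℤ) + i * ((R / 64 / 2 : ℕ) : ℤ)) (2 * (R / 8)) (R / 64 / 2) ⊆
      triAnnulusSet n R' := fun v hv => by
    rw [sepOutComb_strip_iff] at hv
    exact mem_triAnnulusSet_of_cols_rows_out (by omega) (by omega) hRR' hv.1 hv.2.1 (by omega) (by omega)
  have hann : triAnnulusSet n R' ⊆ triAnnulusSet n R' ∪ triOpenBall z'' (R' / 8) := fun v hv => Or.inl hv
  have P1 : PathIn triGraph ((triAnnulusSet n R' ∪ triOpenBall z'' (R' / 8)) ∩ ω) a₀ p₁ := by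
    refine Q1.mono ?_
    exact fun v hv => ⟨R1 hv.1, hv.2⟩
  have P2 : PathIn triGraph ((triAnnulusSet n R' ∪ triOpenBall z'' (R' / 8)) ∩ ω) bh a₀ := by
    refine Q2.symm.mono ?_
    rintro v ⟨hv | hv, hvω⟩
    exacts [⟨R1 hv, hvω⟩, ⟨hann (RVh hv), hvω⟩]
  have P3 : PathIn triGraph ((triAnnulusSet n R' ∪ triOpenBall z'' (R' / 8)) ∩ ω) g₀ bh := by
    refine Q3.mono ?_
    rintro v ⟨hv | hv, hvω⟩
    exacts [⟨hann (RG hv), hvω⟩, ⟨hann (RVh hv), hvω⟩]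
  have P4 : PathIn triGraph ((triAnnulusSet n R' ∪ triOpenBall z'' (R' / 8)) ∩ ω) b g₀ := by
    refine Q4.symm.mono ?_
    rintro v ⟨hv | hv, hvω⟩
    exacts [⟨hann (RG hv), hvω⟩, ⟨hann (R4 hv), hvω⟩]
  have P6 : PathIn triGraph ((triAnnulusSet n R' ∪ triOpenBall z'' (R' / 8)) ∩ ω) u' b := by
    refine Pa.symm.mono ?_
    exact fun v hv => ⟨hann (R4 hv.1), hv.2⟩
  have P7 : PathIn triGraph ((triAnnulusSet n R' ∪ triOpenBall z'' (R' / 8)) ∩ ω) a u' := by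
    refine P.mono ?_
    exact fun v hv => ⟨hann (R5 hv.1), hv.2⟩
  exact ⟨z'', p₁, a, mk_mem_sepLanding R', ha, hFence, ((((P7.trans P6).trans P4).trans P3).trans P2).trans P1⟩

/-- **Outward extension of both arms**: the corridor and its image under the central symmetry
serve the open and the closed arm, `extTwoArm n R ∩ (sepOutCorr R R' ∩ negFlip ⁻¹' sepOutCorr R R') ⊆
extTwoArm n R'`. [cite: Nolin2008, §4.3 Prop. 12 (i) (proof) (arXiv 0711.4948: Prop. 11)] -/
theorem extTwoArm_inter_sepOutCorr_subset {n R R' : ℕ} (hR : 2200 ≤ R) (hnR : 2 * n ≤ R) (hRR' : 2 * R ≤ R') :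
    extTwoArm n R ∩ (sepOutCorr R R' ∩ negFlip ⁻¹' sepOutCorr R R') ⊆ extTwoArm n R' := by
  rintro ω ⟨⟨hO, hC⟩, hG, hG'⟩
  exact ⟨extOpenArm_inter_sepOutCorr_subset hR hnR hRR' ⟨hO, hG⟩, extOpenArm_inter_sepOutCorr_subset hR hnR hRR' ⟨hC, hG'⟩⟩

/-! ### Locality and probability of the corridor -/

/-- The sites of the boxes of the outward corridor. [folklore] -/
def sepOutCorrFinset (R R' : ℕ) : Finset (Site 2) :=
  triStripFinset ((R' : ℤ) + 1) (-((R' / 2 : ℕ) : ℤ) - (R' / 64 : ℕ)) (R' / 16 - 1) (2 * (R' / 64)) ∪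
    triStripFinset ((R : ℤ) + (R / 8 : ℕ) + 1) (-((R' / 2 : ℕ) : ℤ)) (R' + R' / 16 - (R + R / 8 + 1)) (R' / 64) ∪
    triStripFinset ((R : ℤ) + (R / 8 : ℕ) + 1) (-((R' / 2 : ℕ) : ℤ)) (R / 8) (R' / 2) ∪
    (Finset.range 90).biUnion fun i =>
      triStripFinset ((R : ℤ) + 1) (-(sepGlueHeight R : ℤ) + i * ((R / 64 / 2 : ℕ) : ℤ)) (2 * (R / 8)) (R / 64 / 2)

/-- The boxes of the corridor lie in `{R < |v| ≤ R' + R'/8, x₀ > 0}` (`64 ≤ R'`, `2R ≤ R'`). [folklore] -/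
theorem sepOutCorrFinset_subset {R R' : ℕ} (hR' : 64 ≤ R') (hRR' : 2 * R ≤ R') {v : Site 2} (hv : v ∈ sepOutCorrFinset R R') :
    (R : ℤ) < triNorm v ∧ triNorm v ≤ (R' : ℤ) + (R' / 8 : ℕ) ∧ 0 < v 0 := by
  have hH : (sepGlueHeight R : ℤ) = (R : ℤ) - (R / 4 : ℕ) + (R / 64 : ℕ) := by unfold sepGlueHeight; omega
  have hRR : 2 * (R : ℤ) ≤ R' := by exact_mod_cast hRR'
  simp only [sepOutCorrFinset, Finset.mem_union, Finset.mem_biUnion, Finset.mem_range] at hv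
  rcases hv with ((hv | hv) | hv) | ⟨i, hi, hv⟩
  · rw [← Finset.mem_coe, coe_triStripFinset, mem_triStrip] at hv
    have e : ((R' / 16 - 1 : ℕ) : ℤ) = (R' / 16 : ℕ) - 1 := by omega
    rw [e] at hv
    simp only [Nat.cast_mul, Nat.cast_ofNat] at hv
    exact ⟨lt_triNorm_iff_lin.2 (Or.inl (by omega)), triNorm_le_iff_lin.2 (by omega), by omega⟩
  · rw [← Finset.mem_coe, coe_triStripFinset, mem_triStrip, cast_sepOutCorr_width hR' hRR'] at hv
    exact ⟨lt_triNorm_iff_lin.2 (Or.inl (by omega)), triNorm_le_iff_lin.2 (by omega), by omega⟩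
  · rw [← Finset.mem_coe, coe_triStripFinset, mem_triStrip] at hv
    exact ⟨lt_triNorm_iff_lin.2 (Or.inl (by omega)), triNorm_le_iff_lin.2 (by omega), by omega⟩
  · rw [← Finset.mem_coe, coe_triStripFinset, sepOutComb_strip_iff] at hv
    have hih : (0 : ℤ) ≤ (i : ℤ) * ((R / 64 / 2 : ℕ) : ℤ) := by positivity
    have hih' : (i : ℤ) * ((R / 64 / 2 : ℕ) : ℤ) ≤ 89 * ((R / 64 / 2 : ℕ) : ℤ) :=
      mul_le_mul_of_nonneg_right (by exact_mod_cast Nat.le_of_lt_succ hi) (by positivity)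
    exact ⟨lt_triNorm_iff_lin.2 (Or.inl (by omega)), triNorm_le_iff_lin.2 (by omega), by omega⟩

/-- `sepOutCorr` is determined by the sites of its boxes. [folklore] -/
theorem determinedBy_sepOutCorr (R R' : ℕ) : DeterminedBy (sepOutCorr R R') ↑(sepOutCorrFinset R R') := by
  have c1 : (↑(triStripFinset ((R' : ℤ) + 1) (-((R' / 2 : ℕ) : ℤ) - (R' / 64 : ℕ)) (R' / 16 - 1) (2 * (R' / 64))) : Set (Site 2)) ⊆
      ↑(sepOutCorrFinset R R') :=
    Finset.coe_subset.2 (Finset.subset_union_left.trans (Finset.subset_union_left.trans Finset.subset_union_left))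
  have c2 : (↑(triStripFinset ((R : ℤ) + (R / 8 : ℕ) + 1) (-((R' / 2 : ℕ) : ℤ)) (R' + R' / 16 - (R + R / 8 + 1)) (R' / 64)) : Set (Site 2)) ⊆
      ↑(sepOutCorrFinset R R') :=
    Finset.coe_subset.2 (Finset.subset_union_right.trans (Finset.subset_union_left.trans Finset.subset_union_left))
  have c3 : (↑(triStripFinset ((R : ℤ) + (R / 8 : ℕ) + 1) (-((R' / 2 : ℕ) : ℤ)) (R / 8) (R' / 2)) : Set (Site 2)) ⊆
      ↑(sepOutCorrFinset R R') :=
    Finset.coe_subset.2 (Finset.subset_union_right.trans Finset.subset_union_left)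
  have c4 : (↑((Finset.range 90).biUnion fun i : ℕ =>
      triStripFinset ((R : ℤ) + 1) (-(sepGlueHeight R : ℤ) + i * ((R / 64 / 2 : ℕ) : ℤ)) (2 * (R / 8)) (R / 64 / 2)) :
        Set (Site 2)) ⊆ ↑(sepOutCorrFinset R R') :=
    Finset.coe_subset.2 Finset.subset_union_right
  refine ((((determinedBy_triVCross _ _ _ _).mono c1).inter ((determinedBy_triHCross _ _ _ _).mono c2)).inter
    ((determinedBy_triVCross _ _ _ _).mono c3)).inter ?_
  exact (DeterminedBy.biInter_finset (Finset.range 90) (E := fun i => sepOutComb R i)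
    (F := fun i : ℕ => triStripFinset ((R : ℤ) + 1) (-(sepGlueHeight R : ℤ) + i * ((R / 64 / 2 : ℕ) : ℤ)) (2 * (R / 8)) (R / 64 / 2))
    fun i _ => determinedBy_triHCross _ _ _ _).mono c4

/-- **RSW and Harris for the corridor**: if `c ≤ P_{1/2}(long-way crossing of [0, 256 k] × [0, k])`
for all `k ≥ 1` (`c ≥ 0`), then `P(sepOutCorr R R') ≥ c^93` for `64 ≤ R`, `2R ≤ R' ≤ 32R` (all
`93` boxes have aspect ratio at most `256`). [cite: Nolin2008, §4.3 Prop. 12 (proof) (arXiv 0711.4948: Prop. 11)] -/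
theorem le_real_sepOutCorr {c : ℝ} (hrsw : ∀ k : ℕ, 1 ≤ ⌊(256 : ℝ) * k⌋₊ → c ≤ triLRCrossingProb half ⌊(256 : ℝ) * k⌋₊ k)
    (hc : 0 ≤ c) {R R' : ℕ} (hR : 256 ≤ R) (hRR' : 2 * R ≤ R') (hR'R : R' ≤ 32 * R) :
    c ^ 93 ≤ (triSitePercolation half).real (sepOutCorr R R') := by
  classical
  have hfl : ∀ k : ℕ, ⌊(256 : ℝ) * (k : ℕ)⌋₊ = 256 * k := fun k => by
    have : (256 : ℝ) * (k : ℕ) = ((256 * k : ℕ) : ℝ) := by push_cast; ring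
    rw [this, Nat.floor_natCast]
  have hcw : ∀ L k : ℕ, 1 ≤ k → L ≤ 256 * k → c ≤ triLRCrossingProb half L k := fun L k hk hL => by
    have h := hrsw k (by rw [hfl]; omega)
    rw [hfl] at h
    exact h.trans (triLRCrossingProb_anti_width half hL k)
  set F := sepOutCorrFinset R R' with hF
  set E1 := triVCross ((R' : ℤ) + 1) (-((R' / 2 : ℕ) : ℤ) - (R' / 64 : ℕ)) (R' / 16 - 1) (2 * (R' / 64)) with hE1
  set E2 := triHCross ((R : ℤ) + (R / 8 : ℕ) + 1) (-((R' / 2 : ℕ) : ℤ)) (R' + R' / 16 - (R + R / 8 + 1)) (R' / 64) with hE2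
  set E3 := triVCross ((R : ℤ) + (R / 8 : ℕ) + 1) (-((R' / 2 : ℕ) : ℤ)) (R / 8) (R' / 2) with hE3
  set G := ⋂ i ∈ Finset.range 90, sepOutComb R i with hG
  have c1 : (↑(triStripFinset ((R' : ℤ) + 1) (-((R' / 2 : ℕ) : ℤ) - (R' / 64 : ℕ)) (R' / 16 - 1) (2 * (R' / 64))) : Set (Site 2)) ⊆ ↑F :=
    Finset.coe_subset.2 (Finset.subset_union_left.trans (Finset.subset_union_left.trans Finset.subset_union_left))
  have c2 : (↑(triStripFinset ((R : ℤ) + (R / 8 : ℕ) + 1) (-((R' / 2 : ℕ) : ℤ)) (R' + R' / 16 - (R + R / 8 + 1)) (R' / 64)) : Set (Site 2)) ⊆ ↑F :=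
    Finset.coe_subset.2 (Finset.subset_union_right.trans (Finset.subset_union_left.trans Finset.subset_union_left))
  have c3 : (↑(triStripFinset ((R : ℤ) + (R / 8 : ℕ) + 1) (-((R' / 2 : ℕ) : ℤ)) (R / 8) (R' / 2)) : Set (Site 2)) ⊆ ↑F :=
    Finset.coe_subset.2 (Finset.subset_union_right.trans Finset.subset_union_left)
  have c4 : (↑((Finset.range 90).biUnion fun i : ℕ =>
      triStripFinset ((R : ℤ) + 1) (-(sepGlueHeight R : ℤ) + i * ((R / 64 / 2 : ℕ) : ℤ)) (2 * (R / 8)) (R / 64 / 2)) :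
        Set (Site 2)) ⊆ ↑F :=
    Finset.coe_subset.2 Finset.subset_union_right
  have d1 : DeterminedBy E1 ↑F := (determinedBy_triVCross _ _ _ _).mono c1
  have d2 : DeterminedBy E2 ↑F := (determinedBy_triHCross _ _ _ _).mono c2
  have d3 : DeterminedBy E3 ↑F := (determinedBy_triVCross _ _ _ _).mono c3
  have dG : DeterminedBy G ↑F := (DeterminedBy.biInter_finset (Finset.range 90) (E := fun i => sepOutComb R i)
    (F := fun i : ℕ => triStripFinset ((R : ℤ) + 1) (-(sepGlueHeight R : ℤ) + i * ((R / 64 / 2 : ℕ) : ℤ)) (2 * (R / 8)) (R / 64 / 2))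
    fun i _ => determinedBy_triHCross _ _ _ _).mono c4
  have u1 : IsUpperSet E1 := isUpperSet_triVCross _ _ _ _
  have u2 : IsUpperSet E2 := isUpperSet_triHCross _ _ _ _
  have u3 : IsUpperSet E3 := isUpperSet_triVCross _ _ _ _
  have uG : IsUpperSet G := isUpperSet_iInter₂ fun i _ => isUpperSet_triHCross _ _ _ _
  have hH1 : 1 ≤ R / 8 := by omega
  have e1 : c ≤ (triSitePercolation half).real E1 := by
    rw [hE1, triSitePercolation_real_triVCross]; exact hcw _ _ (by omega) (by omega)
  have e2 : c ≤ (triSitePercolation half).real E2 := by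
    rw [hE2, triSitePercolation_real_triHCross]; exact hcw _ _ (by omega) (by omega)
  have e3 : c ≤ (triSitePercolation half).real E3 := by
    rw [hE3, triSitePercolation_real_triVCross]; exact hcw _ _ hH1 (by omega)
  have eG : c ^ 90 ≤ (triSitePercolation half).real G := by
    have hprod := sitePercolation_real_biInter_ge_prod half (Finset.range 90) (E := fun i => sepOutComb R i)
      (F := fun i => triStripFinset ((R : ℤ) + 1) (-(sepGlueHeight R : ℤ) + i * ((R / 64 / 2 : ℕ) : ℤ)) (2 * (R / 8)) (R / 64 / 2))
      (fun i _ => determinedBy_triHCross _ _ _ _) (fun i _ => isUpperSet_triHCross _ _ _ _)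
    have heach : ∀ i ∈ Finset.range 90, c ≤ (sitePercolation (Site 2) half).real (sepOutComb R i) := fun i _ => by
      have := triSitePercolation_real_triHCross half ((R : ℤ) + 1)
        (-(sepGlueHeight R : ℤ) + i * ((R / 64 / 2 : ℕ) : ℤ)) (2 * (R / 8)) (R / 64 / 2)
      unfold triSitePercolation at this
      rw [sepOutComb, this]
      exact hcw _ _ (by omega) (by omega)
    have hle : c ^ 90 ≤ ∏ i ∈ Finset.range 90, (sitePercolation (Site 2) half).real (sepOutComb R i) := by
      calc c ^ 90 = ∏ _i ∈ Finset.range 90, c := by rw [Finset.prod_const, Finset.card_range]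
        _ ≤ _ := Finset.prod_le_prod (fun _ _ => hc) heach
    unfold triSitePercolation
    exact hle.trans hprod
  have h12 := sitePercolation_harris half d1 d2 u1 u2
  have h123 := sitePercolation_harris half (d1.inter d2) d3 (u1.inter u2) u3
  have h1234 := sitePercolation_harris half ((d1.inter d2).inter d3) dG ((u1.inter u2).inter u3) uG
  have hdef : sepOutCorr R R' = E1 ∩ E2 ∩ E3 ∩ G := rfl
  unfold triSitePercolation at e1 e2 e3 eG ⊢
  rw [hdef]
  set μ := sitePercolation (Site 2) half with hμ
  have h0 : ∀ s, 0 ≤ μ.real s := fun s => measureReal_nonneg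
  calc c ^ 93 = c * c * c * c ^ 90 := by ring
    _ ≤ μ.real E1 * μ.real E2 * μ.real E3 * μ.real G := by
        have := mul_le_mul e1 e2 hc (h0 _)
        have := mul_le_mul this e3 hc (mul_nonneg (h0 _) (h0 _))
        exact mul_le_mul this eG (pow_nonneg hc _) (mul_nonneg (mul_nonneg (h0 _) (h0 _)) (h0 _))
    _ ≤ μ.real (E1 ∩ E2) * μ.real E3 * μ.real G :=
        mul_le_mul_of_nonneg_right (mul_le_mul_of_nonneg_right h12 (h0 _)) (h0 _)
    _ ≤ μ.real (E1 ∩ E2 ∩ E3) * μ.real G := mul_le_mul_of_nonneg_right h123 (h0 _)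
    _ ≤ μ.real (E1 ∩ E2 ∩ E3 ∩ G) := h1234

/-! ### The extension inequality -/

/-- **Outward extension at constant cost** (Nolin 2008, Prop. 12 (i) on the external boundary,
via Lemma 13; §4.4 p. 12, the constant `C₀`): if `c ≤ P_{1/2}(long-way crossing of
[0, 256 k] × [0, k])` for all `k ≥ 1` (`c ≥ 0`), then for `2200 ≤ R`, `2n ≤ R`, `2R ≤ R' ≤ 32R`,
`P(extTwoArm n R) · (c^93)² ≤ P(extTwoArm n R')`: the generalised FKG inequality
(`triSitePercolation_locallyMonotone_fkg`) with the shared region `{n ≤ |v| ≤ R}` (on which both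
landed arm events depend inside `Λ_R`), the region `{R < |v|, x₀ > 0}` (the open arm's outer free
spaces and the open corridor) and `{R < |v|, x₀ < 0}` (the closed arm's), the invariance of `P_{1/2}`
under `negFlip`, and the deterministic gluing `extTwoArm_inter_sepOutCorr_subset`. [cite: Nolin2008, §4.3 Prop. 12 (i) and Lemma 13 (arXiv 0711.4948: Prop. 11, Lemma 12); §4.4 p. 12] -/
theorem real_extTwoArm_mul_le_outward {c : ℝ} (hrsw : ∀ k : ℕ, 1 ≤ ⌊(256 : ℝ) * k⌋₊ → c ≤ triLRCrossingProb half ⌊(256 : ℝ) * k⌋₊ k)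
    (hc : 0 ≤ c) {n R R' : ℕ} (hR : 2200 ≤ R) (hnR : 2 * n ≤ R) (hRR' : 2 * R ≤ R') (hR'R : R' ≤ 32 * R) :
    (triSitePercolation half).real (extTwoArm n R) * (c ^ 93) ^ 2 ≤ (triSitePercolation half).real (extTwoArm n R') := by
  classical
  -- the three pairwise disjoint regions of Nolin's Lemma 13
  set S : Finset (Site 2) := (triBall R).filter (fun v => (n : ℤ) ≤ triNorm v) with hS
  set P : Finset (Site 2) := (triBall (R' + R' / 8)).filter (fun v => (R : ℤ) < triNorm v ∧ 0 < v 0) with hP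
  set M : Finset (Site 2) := (triBall (R' + R' / 8)).filter (fun v => (R : ℤ) < triNorm v ∧ v 0 < 0) with hM
  have hSP : Disjoint S P := by
    rw [Finset.disjoint_left]; intro v hvS hvP
    simp only [hS, hP, Finset.mem_filter, mem_triBall_iff] at hvS hvP
    omega
  have hSM : Disjoint S M := by
    rw [Finset.disjoint_left]; intro v hvS hvM
    simp only [hS, hM, Finset.mem_filter, mem_triBall_iff] at hvS hvM
    omega
  have hPM : Disjoint P M := by
    rw [Finset.disjoint_left]; intro v hvP hvM
    simp only [hP, hM, Finset.mem_filter] at hvP hvM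
    omega
  have hRR : 2 * (R : ℤ) ≤ R' := by exact_mod_cast hRR'
  have h88 : (R : ℤ) + (R / 8 : ℕ) ≤ (R' : ℤ) + (R' / 8 : ℕ) := by omega
  -- supports
  have hT : extSupportSet n R ⊆ ↑S ∪ ↑P := by
    intro v hv
    rw [mem_extSupportSet] at hv
    simp only [hS, hP, Set.mem_union, Finset.mem_coe, Finset.mem_filter, mem_triBall_iff]
    push_cast at hv ⊢
    by_cases h : triNorm v ≤ (R : ℤ)
    · left; exact ⟨h, hv.1⟩
    · right; exact ⟨by omega, by omega, hv.2.2 (by omega)⟩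
  have hT' : Neg.neg ⁻¹' extSupportSet n R ⊆ ↑S ∪ ↑M := by
    intro v hv
    rw [Set.mem_preimage, mem_extSupportSet, triNorm_neg] at hv
    simp only [Pi.neg_apply] at hv
    simp only [hS, hM, Set.mem_union, Finset.mem_coe, Finset.mem_filter, mem_triBall_iff]
    push_cast at hv ⊢
    by_cases h : triNorm v ≤ (R : ℤ)
    · left; exact ⟨h, hv.1⟩
    · right; exact ⟨by omega, by omega, by have := hv.2.2 (by omega); omega⟩
  have hGP : (↑(sepOutCorrFinset R R') : Set (Site 2)) ⊆ ↑P := by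
    intro v hv
    have h := sepOutCorrFinset_subset (by omega) hRR' (Finset.mem_coe.1 hv)
    simp only [hP, Finset.mem_coe, Finset.mem_filter, mem_triBall_iff]
    push_cast
    exact ⟨h.2.1, h.1, h.2.2⟩
  have hGM : Neg.neg ⁻¹' (↑(sepOutCorrFinset R R') : Set (Site 2)) ⊆ ↑M := by
    intro v hv
    have h := sepOutCorrFinset_subset (by omega) hRR' (Finset.mem_coe.1 (Set.mem_preimage.1 hv))
    rw [triNorm_neg] at h
    simp only [Pi.neg_apply] at h
    simp only [hM, Finset.mem_coe, Finset.mem_filter, mem_triBall_iff]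
    push_cast
    exact ⟨h.2.1, h.1, by omega⟩
  -- locality of the events and Nolin's Lemma 13
  have d := determinedBy_extOpenArm (n := n) (N := R) hnR
  have dG := determinedBy_sepOutCorr R R'
  have fkg := triSitePercolation_locallyMonotone_fkg half hSP hSM hPM
    (Ap := extOpenArm n R) (Am := negFlip ⁻¹' extOpenArm n R) (Bp := sepOutCorr R R') (Bm := negFlip ⁻¹' sepOutCorr R R')
    (isUpperSet_extOpenArm n R) (IsUpperSet.preimage_negFlip (isUpperSet_extOpenArm n R))
    (isUpperSet_sepOutCorr R R') (IsUpperSet.preimage_negFlip (isUpperSet_sepOutCorr R R'))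
    (d.mono hT) (d.preimage_negFlip.mono hT') (dG.mono hGP) (dG.preimage_negFlip.mono hGM)
  have hGG := triSitePercolation_real_preimage_negFlip (sepOutCorr R R')
  have hcorr := le_real_sepOutCorr hrsw hc (by omega) hRR' hR'R
  have hsub := extTwoArm_inter_sepOutCorr_subset hR hnR hRR'
  have h0 : 0 ≤ (triSitePercolation half).real (extTwoArm n R) := measureReal_nonneg
  calc (triSitePercolation half).real (extTwoArm n R) * (c ^ 93) ^ 2
      ≤ (triSitePercolation half).real (extTwoArm n R) *
          ((triSitePercolation half).real (sepOutCorr R R') * (triSitePercolation half).real (negFlip ⁻¹' sepOutCorr R R')) := by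
        rw [hGG, sq]
        exact mul_le_mul_of_nonneg_left (mul_le_mul hcorr hcorr (pow_nonneg hc _) measureReal_nonneg) h0
    _ ≤ (triSitePercolation half).real (extOpenArm n R ∩ negFlip ⁻¹' extOpenArm n R ∩ (sepOutCorr R R' ∩ negFlip ⁻¹' sepOutCorr R R')) := fkg
    _ ≤ (triSitePercolation half).real (extTwoArm n R') := measureReal_mono hsub

/-- **The outward extension constant exists**: there is `C₀ ≥ 1` with
`P(extTwoArm n R) ≤ C₀ · P(extTwoArm n R')` for all `2200 ≤ R`, `2n ≤ R`, `2R ≤ R' ≤ 32R`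
(`tri_rsw_half_holds` at aspect ratio `256`). [cite: Nolin2008, §4.3 Prop. 12 (i) (arXiv 0711.4948: Prop. 11); §4.4 p. 12 (constant C₀)] -/
theorem exists_real_extTwoArm_le_mul_outward :
    ∃ C₀ : ℝ, 1 ≤ C₀ ∧ ∀ n R R' : ℕ, 2200 ≤ R → 2 * n ≤ R → 2 * R ≤ R' → R' ≤ 32 * R →
      (triSitePercolation half).real (extTwoArm n R) ≤ C₀ * (triSitePercolation half).real (extTwoArm n R') := by
  obtain ⟨c, hc, hrsw⟩ := tri_rsw_half_holds 256 (by norm_num)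
  have hc1 : c ≤ 1 := by
    have h := (hrsw 1 (by norm_num)).1
    exact h.trans measureReal_le_one
  have hq : 0 < (c ^ 93) ^ 2 := by positivity
  refine ⟨1 / (c ^ 93) ^ 2, ?_, fun n R R' hR hnR hRR' hR'R => ?_⟩
  · rw [le_div_iff₀ hq, one_mul]
    calc (c ^ 93) ^ 2 ≤ (1 : ℝ) ^ 2 := by gcongr; exact pow_le_one₀ hc.le hc1
      _ = 1 := one_pow 2
  · have h := real_extTwoArm_mul_le_outward (fun k hk => (hrsw k hk).1) hc.le hR hnR hRR' hR'R
    rw [one_div, ← div_eq_inv_mul, le_div_iff₀ hq]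
    exact h

end Literature.Probability.Percolation
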